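import Literature.Barriers.CriticalPhenomena.LaceExpansionGaussianDeconvolutionLem29
import Literature.Barriers.CriticalPhenomena.LaceExpansionGaussianDeconvolutionWL
import Literature.Analysis.FunctionSpaces.TorusTrigPoly
import Literature.Analysis.FunctionSpaces.TorusCalculusProofs
import Mathlib.Analysis.Normed.Group.AddCircle
import HarnessLib

/-!
# Liu–Slade 2024, Proposition 2.4: torus-side preliminaries
# (power weights in `L^p(𝕋^d)`, iterated derivatives of trigonometric polynomials, classical
# derivatives as weak derivatives, weak Lebesgue classes)

Barrier catalogue `Literature/Barriers/CriticalPhenomena/` (D-0021), first support file (all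
results proved, no named facts) for the discharge of the named fact `LiuSlade2024_prop24`
(Liu–Slade 2024, Proposition 2.4: "`f̂ = ĈÊĜ` is `n_d` times weakly differentiable", with the `L¹`
bounds of its proof) of `LaceExpansionGaussianDeconvolution.lean`. The printed proof (§2.2.1 with
Lemmas 2.2, 2.5, 2.6 and Appendix A) computes `f̂_α` by the product and quotient rules for WEAK
derivatives (Lemmas A.2–A.3, via mollification and the ACL characterisation) applied to
`Ê/(ÂF̂)`, and bounds each term in `L¹(𝕋^d)` by Hölder's inequality. In Lean the weak-derivative
calculus is replaced by CLASSICAL calculus on smooth approximants (the transform of the truncation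
of `F` to finite support is a trigonometric polynomial; the denominators are shifted by `κ > 0`)
followed by a weak limit, and this file supplies the torus-side tools of that argument, on
Mathlib's `UnitAddTorus (Fin d)` with its Haar probability measure (the setting of the main file):

* `tnorm t = (Σ_i ‖t_i‖²)^{1/2}` (`= |k|/2π` for `k = 2πt ∈ (-π,π]^d`), and the power weights:
  `lintegral_tnorm_rpow_neg_lt_top`, `integrable_tnorm_rpow_neg`, `memLp_tnorm_rpow_neg` —
  `‖t‖^{-s} ∈ L^p(𝕋^d)` for `sp < d` (fundamental domain `(-1/2,1/2]^d`, Mathlib's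
  `UnitAddTorus.lintegral_preimage`, and the tree's `integrableOn_pi_norm_rpow_neg_ball`);
* `iterL l u` — the partial derivatives along a word `l` applied in reading order, and
  `IsSmooth.hasTorusWeakDeriv_iterL`: for smooth `u`, `iterL l u` is the weak derivative of `u`
  for `l` in the sense of Definition A.1 (`HasTorusWeakDeriv`), by iterated integration by parts on
  the torus (the tree's `Torus.IsSmooth.hasWeakPartialDeriv`, `Torus.integral_partialDeriv_eq_zero_holds`);
* `wordMul l x = (2πi x)^l` and `iterL_trigPoly`: `∂^l Σ_x e_x c_x = Σ_x e_x (2πi x)^l c_x` for the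
  tree's trigonometric polynomials `Torus.trigPoly` (Lemma A.4 for finite sums is classical);
  `latticeFourier_eq_trigPoly` (the transform of a finitely supported `F` is such a polynomial);
* `IsWLT d t Φ` — the WEAK LEBESGUE CLASSES on `𝕋^d`, the torus-side complex-valued twin (same API,
  same proofs) of the cube-side `LS24.IsWL` of `LaceExpansionGaussianDeconvolutionWL.lean`: a family
  `Φ_i : 𝕋^d → ℂ` is of class `t` if `sup_i ‖Φ_i‖_p < ∞` for all real `p ≥ 1` with `t/d < 1/p`;
  closure under sums, bounded multiples, domination, products (`IsWLT.mul`, `IsWLT.list_prod`: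
  Hölder's inequality, classes add — the bookkeeping "`r⁻¹ = Σ r_n⁻¹ + q⁻¹ + Σ q_m⁻¹ >
  (|α| + 2 - σ)/d`" of the proof of Proposition 2.4), the members `‖t‖^{-s}` (class `s`) and
  bounded families (class `0`), classes from `L^q` bounds at exponents `q ≥ 2`
  (`isWLT_of_bound_two_le`, the form in which Hausdorff–Young-type bounds enter), and the uniform
  `L¹`/`L^p` bounds they deliver (`IsWLT.exists_integral_le`, `IsWLT.exists_integral_rpow_le`).

## References

* Y. Liu, G. Slade, *Gaussian deconvolution and the lace expansion*, Probab. Theory Related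
  Fields 195 (2024) 3–29, arXiv:2310.07635: §2.2.1 (proof of Proposition 2.4), §2.2.2 (Lemma 2.5,
  Lemma 2.6), Appendix A (Definition A.1, Lemma A.4) [LiuSlade2024].
-/

noncomputable section

namespace Literature.Barriers.CriticalPhenomena.SpreadOutIsing

open Filter Finset UnitAddTorus Literature.Probability.LatticeModels Real
open Literature.Analysis.FunctionSpaces Literature.Analysis.FunctionSpaces.Torus
open _root_.MeasureTheory _root_.Topology
open scoped ENNReal NNReal

variable {d : ℕ}

/-! ## The torus norm `‖t‖ = (Σ_i ‖t_i‖²)^{1/2}` -/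

/-- `‖t‖ = (Σ_i ‖t_i‖²)^{1/2}` on `(ℝ/ℤ)^d` (`‖·‖` the quotient norm of `ℝ/ℤ`), i.e. `|k|/(2π)` for
`k = 2πt ∈ (-π,π]^d`. [folklore] -/
def tnorm (t : UnitAddTorus (Fin d)) : ℝ := Real.sqrt (∑ i, ‖t i‖ ^ 2)

/-- `‖t‖ ≥ 0`. [folklore] -/
theorem tnorm_nonneg (t : UnitAddTorus (Fin d)) : 0 ≤ tnorm t := Real.sqrt_nonneg _

/-- `‖t‖² = Σ_i ‖t_i‖²`. [folklore] -/
theorem tnorm_sq (t : UnitAddTorus (Fin d)) : tnorm t ^ 2 = ∑ i, ‖t i‖ ^ 2 :=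
  Real.sq_sqrt (Finset.sum_nonneg fun _ _ => sq_nonneg _)

/-- `‖t_i‖ ≤ ‖t‖`. [folklore] -/
theorem norm_apply_le_tnorm (t : UnitAddTorus (Fin d)) (i : Fin d) : ‖t i‖ ≤ tnorm t := by
  unfold tnorm
  rw [← Real.sqrt_sq (norm_nonneg (t i))]
  exact Real.sqrt_le_sqrt (Finset.single_le_sum (fun j _ => sq_nonneg ‖t j‖) (Finset.mem_univ i))

/-- `‖t‖ = 0 ↔ t = 0`. [folklore] -/
theorem tnorm_eq_zero_iff (t : UnitAddTorus (Fin d)) : tnorm t = 0 ↔ t = 0 := by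
  constructor
  · intro h
    funext i
    have hi := norm_apply_le_tnorm t i
    rw [h] at hi
    exact norm_eq_zero.1 (le_antisymm hi (norm_nonneg _))
  · rintro rfl
    simp [tnorm]

/-- `‖t‖ > 0` for `t ≠ 0`. [folklore] -/
theorem tnorm_pos {t : UnitAddTorus (Fin d)} (ht : t ≠ 0) : 0 < tnorm t :=
  lt_of_le_of_ne (tnorm_nonneg t) (fun h => ht ((tnorm_eq_zero_iff t).1 h.symm))

/-- `‖t‖ ≤ √d/2` (each `‖t_i‖ ≤ 1/2`). [folklore] -/
theorem tnorm_le (t : UnitAddTorus (Fin d)) : tnorm t ≤ Real.sqrt d / 2 := by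
  unfold tnorm
  have h : ∑ i, ‖t i‖ ^ 2 ≤ ∑ _i : Fin d, (1 / 2 : ℝ) ^ 2 := by
    refine Finset.sum_le_sum fun i _ => ?_
    have := AddCircle.norm_le_half_period (1 : ℝ) one_ne_zero (x := t i)
    rw [abs_one] at this
    exact pow_le_pow_left₀ (norm_nonneg _) this 2
  calc Real.sqrt (∑ i, ‖t i‖ ^ 2) ≤ Real.sqrt (∑ _i : Fin d, (1 / 2 : ℝ) ^ 2) := Real.sqrt_le_sqrt h
    _ = Real.sqrt d / 2 := by
        rw [Finset.sum_const, Finset.card_univ, Fintype.card_fin, nsmul_eq_mul,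
          Real.sqrt_mul (Nat.cast_nonneg d), Real.sqrt_sq (by norm_num)]
        ring

/-- `t ↦ ‖t‖` is continuous. [folklore] -/
theorem continuous_tnorm : Continuous (tnorm : UnitAddTorus (Fin d) → ℝ) := by
  unfold tnorm
  fun_prop

/-- On the fundamental domain `(-1/2,1/2]^d`, `‖t_i‖ = |y_i|`. [folklore] -/
theorem norm_coe_of_mem_Ioc {y : ℝ} (hy : y ∈ Set.Ioc (-(1 / 2 : ℝ)) (-(1 / 2) + 1)) :
    ‖((y : ℝ) : UnitAddCircle)‖ = |y| := by
  rw [AddCircle.norm_coe_eq_abs_iff (1 : ℝ) one_ne_zero, abs_one]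
  rw [abs_le]
  constructor <;> linarith [hy.1, hy.2]

/-- On the fundamental domain `(-1/2,1/2]^d`, the torus norm dominates the sup norm of `ℝ^d`.
[folklore] -/
theorem pi_norm_le_tnorm_coe {y : Fin d → ℝ} (hy : ∀ i, y i ∈ Set.Ioc (-(1 / 2 : ℝ)) (-(1 / 2) + 1)) :
    ‖y‖ ≤ tnorm (fun i => ((y i : ℝ) : UnitAddCircle)) := by
  refine (pi_norm_le_iff_of_nonneg (tnorm_nonneg _)).2 fun i => ?_
  have h := norm_apply_le_tnorm (fun i => ((y i : ℝ) : UnitAddCircle)) i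
  rw [norm_coe_of_mem_Ioc (hy i)] at h
  rwa [Real.norm_eq_abs]

/-- **`∫_{𝕋^d} ‖t‖^{-s} dt < ∞` for `0 ≤ s < d`** (fundamental domain `(-1/2,1/2]^d`, where
`‖t‖ ≥ ‖y‖_∞`, and polar coordinates). [folklore] -/
theorem lintegral_tnorm_rpow_neg_lt_top (hd : 1 ≤ d) {s : ℝ} (hs0 : 0 ≤ s) (hs : s < d) :
    ∫⁻ t : UnitAddTorus (Fin d), ENNReal.ofReal (tnorm t ^ (-s)) < ∞ := by
  rw [volume_eq_pi_haarAddCircle]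
  have h := UnitAddTorus.lintegral_preimage (fun t : UnitAddTorus (Fin d) => ENNReal.ofReal (tnorm t ^ (-s)))
    (fun _ => -(1 / 2 : ℝ))
  erw [h]
  set B : Set (Fin d → ℝ) := {x | ∀ i, x i ∈ Set.Ioc (-(1 / 2 : ℝ)) (-(1 / 2) + 1)} with hB
  have hsub : B ⊆ Metric.ball (0 : Fin d → ℝ) 1 := by
    intro x hx
    rw [Metric.mem_ball, dist_zero_right, pi_norm_lt_iff one_pos]
    intro i
    have := hx i
    rw [Real.norm_eq_abs, abs_lt]
    constructor <;> linarith [this.1, this.2]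
  have hint := integrableOn_pi_norm_rpow_neg_ball hd hs (1 : ℝ)
  have hBm : MeasurableSet B := by
    have : B = Set.pi Set.univ (fun _ => Set.Ioc (-(1 / 2 : ℝ)) (-(1 / 2) + 1)) := by
      ext x; simp [hB]
    rw [this]
    exact MeasurableSet.univ_pi fun _ => measurableSet_Ioc
  have hfin : ∫⁻ x in Metric.ball (0 : Fin d → ℝ) 1, ENNReal.ofReal (‖x‖ ^ (-s)) < ∞ :=
    (hasFiniteIntegral_iff_ofReal (ae_of_all _ fun x => Real.rpow_nonneg (norm_nonneg x) _)).1 hint.2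
  calc ∫⁻ x in B, ENNReal.ofReal (tnorm (fun i => ((x i : ℝ) : UnitAddCircle)) ^ (-s))
      ≤ ∫⁻ x in B, ENNReal.ofReal (‖x‖ ^ (-s)) := by
        refine setLIntegral_mono' hBm fun x hx => ENNReal.ofReal_le_ofReal ?_
        by_cases hx0 : ‖x‖ = 0
        · have : x = 0 := norm_eq_zero.1 hx0
          subst this
          have h0 : tnorm (fun i : Fin d => (((0 : Fin d → ℝ) i : ℝ) : UnitAddCircle)) = 0 := by
            rw [tnorm_eq_zero_iff]; funext i; simp
          rw [h0, norm_zero]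
        · exact Real.rpow_le_rpow_of_nonpos (lt_of_le_of_ne (norm_nonneg x) (Ne.symm hx0))
            (pi_norm_le_tnorm_coe hx) (by linarith)
    _ ≤ ∫⁻ x in Metric.ball (0 : Fin d → ℝ) 1, ENNReal.ofReal (‖x‖ ^ (-s)) :=
        lintegral_mono_set hsub
    _ < ∞ := hfin

/-- `t ↦ ‖t‖^{-s}` is integrable on `𝕋^d` for `0 ≤ s < d`. [folklore] -/
theorem integrable_tnorm_rpow_neg (hd : 1 ≤ d) {s : ℝ} (hs0 : 0 ≤ s) (hs : s < d) :
    Integrable (fun t : UnitAddTorus (Fin d) => tnorm t ^ (-s)) := by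
  refine ⟨(continuous_tnorm.measurable.pow_const _).aestronglyMeasurable, ?_⟩
  rw [hasFiniteIntegral_iff_ofReal (ae_of_all _ fun t => Real.rpow_nonneg (tnorm_nonneg t) _)]
  exact lintegral_tnorm_rpow_neg_lt_top hd hs0 hs

/-- `t ↦ ‖t‖^{-a}` is in `L^p(𝕋^d)` for `0 ≤ a`, `0 < p < ∞`, `ap < d`. [folklore] -/
theorem memLp_tnorm_rpow_neg (hd : 1 ≤ d) {a p : ℝ} (ha : 0 ≤ a) (hp : 0 < p) (hap : a * p < d) :
    MemLp (fun t : UnitAddTorus (Fin d) => tnorm t ^ (-a)) (ENNReal.ofReal p) := by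
  have hmeas : AEStronglyMeasurable (fun t : UnitAddTorus (Fin d) => tnorm t ^ (-a)) volume :=
    (continuous_tnorm.measurable.pow_const _).aestronglyMeasurable
  rw [← integrable_norm_rpow_iff hmeas (by simpa using hp) ENNReal.ofReal_ne_top]
  rw [ENNReal.toReal_ofReal hp.le]
  have h := integrable_tnorm_rpow_neg hd (mul_nonneg ha hp.le) hap
  refine h.congr (ae_of_all _ fun t => ?_)
  simp only
  rw [Real.norm_eq_abs, abs_of_nonneg (Real.rpow_nonneg (tnorm_nonneg t) _),
    ← Real.rpow_mul (tnorm_nonneg t)]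
  ring_nf

/-! ## Iterated partial derivatives along a word, applied left to right -/

section IterL

variable {F : Type*} [NormedAddCommGroup F] [NormedSpace ℝ F]

/-- `iterL [l₁, …, l_m] u = ∂_{l_m} ⋯ ∂_{l₂} ∂_{l₁} u`: the partial derivatives along the word `l`
applied in reading order (first `∂_{l₁}`). For smooth `u` this is the weak derivative of `u` for
the multi-index word `l` in the sense of `HasTorusWeakDeriv` (whose test-function side
`iterPartialDeriv l φ = ∂_{l₁}(∂_{l₂}(⋯ φ))` peels `∂_{l₁}` off first). [folklore] -/
def iterL (l : List (Fin d)) (u : UnitAddTorus (Fin d) → F) : UnitAddTorus (Fin d) → F :=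
  l.foldl (fun ψ i => Torus.partialDeriv i ψ) u

/-- `∂^{[]} u = u`. [folklore] -/
@[simp] theorem iterL_nil (u : UnitAddTorus (Fin d) → F) : iterL ([] : List (Fin d)) u = u := rfl

/-- `∂^{i :: l} u = ∂^{l} (∂ᵢ u)` (reading order). [folklore] -/
@[simp] theorem iterL_cons (i : Fin d) (l : List (Fin d)) (u : UnitAddTorus (Fin d) → F) :
    iterL (i :: l) u = iterL l (Torus.partialDeriv i u) := rfl

/-- `∂^{l ++ l'} u = ∂^{l'} (∂^{l} u)`. [folklore] -/
theorem iterL_append (l l' : List (Fin d)) (u : UnitAddTorus (Fin d) → F) :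
    iterL (l ++ l') u = iterL l' (iterL l u) := by
  simp [iterL, List.foldl_append]

/-- `∂^{l ++ [j]} u = ∂ⱼ (∂^{l} u)`. [folklore] -/
theorem iterL_concat (l : List (Fin d)) (j : Fin d) (u : UnitAddTorus (Fin d) → F) :
    iterL (l ++ [j]) u = Torus.partialDeriv j (iterL l u) := by
  rw [iterL_append]; rfl

/-- Iterated partial derivatives of smooth functions are smooth. [folklore] -/
theorem isSmooth_iterL {u : UnitAddTorus (Fin d) → F} (hu : IsSmooth u) :
    ∀ l : List (Fin d), IsSmooth (iterL l u) := by
  intro l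
  induction l generalizing u with
  | nil => exact hu
  | cons i l ih => exact ih (hu.partialDeriv i)

end IterL

/-- Iterated partial derivatives (`iterPartialDeriv`, test-function side) of smooth real functions
are smooth. [folklore] -/
theorem isSmooth_iterPartialDeriv {φ : UnitAddTorus (Fin d) → ℝ} (hφ : IsSmooth φ) :
    ∀ l : List (Fin d), IsSmooth (iterPartialDeriv l φ)
  | [] => hφ
  | i :: l => by
    rw [iterPartialDeriv_cons]
    exact (isSmooth_iterPartialDeriv hφ l).partialDeriv i

/-- **Classical derivatives of smooth functions are weak derivatives (all orders).** For smooth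
`u : 𝕋^d → ℂ` and every word `l`, `iterL l u` is the weak derivative of `u` for `l` in the sense of
Definition A.1 (`HasTorusWeakDeriv`): induction on `l`, each step being the integration by parts
`∫ ∂ᵢψ • u = -∫ ψ • ∂ᵢu` on the torus (`Torus.IsSmooth.hasWeakPartialDeriv` with
`Torus.integral_partialDeriv_eq_zero_holds`). [cite: LiuSlade2024, Appendix A, Definition A.1 ("If u is classically differentiable then (A.1) holds by the usual integration by parts formula")] -/
theorem IsSmooth.hasTorusWeakDeriv_iterL {u : UnitAddTorus (Fin d) → ℂ} (hu : IsSmooth u)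
    (l : List (Fin d)) : HasTorusWeakDeriv u l (iterL l u) := by
  induction l generalizing u with
  | nil => exact hasTorusWeakDeriv_nil hu.integrable
  | cons i l ih =>
    refine ⟨hu.integrable, (isSmooth_iterL hu (i :: l)).integrable, fun φ hφ => ?_⟩
    have h1 : ∫ t, Torus.partialDeriv i (iterPartialDeriv l φ) t • u t =
        -∫ t, iterPartialDeriv l φ t • Torus.partialDeriv i u t :=
      Torus.IsSmooth.hasWeakPartialDeriv integral_partialDeriv_eq_zero_holds hu i _
        (isSmooth_iterPartialDeriv hφ l)
    have h2 := (ih (hu.partialDeriv i)).2.2 φ hφ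
    rw [iterPartialDeriv_cons, h1, h2, iterL_cons, List.length_cons, pow_succ]
    ring

/-! ## Trigonometric polynomials `Σ_{x ∈ S} e_x c_x` (the tree's `Torus.trigPoly`) and their
iterated derivatives -/

section TrigPoly

/-- The multiplier `(2πi x)^l = Π_{j ∈ l} (2πi x_j)` of the word `l`. [folklore] -/
def wordMul (l : List (Fin d)) (x : Site d) : ℂ :=
  (l.map fun j => (2 * π * Complex.I * (x j : ℂ))).prod

/-- `(2πi x)^{[]} = 1`. [folklore] -/
@[simp] theorem wordMul_nil (x : Site d) : wordMul ([] : List (Fin d)) x = 1 := by simp [wordMul]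

/-- `(2πi x)^{i :: l} = (2πi xᵢ)(2πi x)^l`. [folklore] -/
@[simp] theorem wordMul_cons (i : Fin d) (l : List (Fin d)) (x : Site d) :
    wordMul (i :: l) x = (2 * π * Complex.I * (x i : ℂ)) * wordMul l x := by simp [wordMul]

/-- `(2πi x)^{l ++ l'} = (2πi x)^l (2πi x)^{l'}`. [folklore] -/
theorem wordMul_append (l l' : List (Fin d)) (x : Site d) :
    wordMul (l ++ l') x = wordMul l x * wordMul l' x := by
  simp [wordMul, List.map_append, List.prod_append]

/-- `|(2πi x)^l| = Π_{j ∈ l} 2π|x_j|`. [folklore] -/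
theorem norm_wordMul (l : List (Fin d)) (x : Site d) :
    ‖wordMul l x‖ = (l.map fun j => 2 * π * |(x j : ℝ)|).prod := by
  induction l with
  | nil => simp
  | cons i l ih =>
    rw [wordMul_cons, norm_mul, ih, List.map_cons, List.prod_cons]
    congr 1
    rw [norm_mul, norm_mul, norm_mul, Complex.norm_I, mul_one, Complex.norm_intCast,
      Complex.norm_real, Real.norm_eq_abs, abs_of_pos Real.pi_pos, Complex.norm_two]

/-- `|(2πi x)^l| ≤ (2π|x|)^{|l|}`. [folklore] -/
theorem norm_wordMul_le (l : List (Fin d)) (x : Site d) :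
    ‖wordMul l x‖ ≤ (2 * π * euclidNorm x) ^ l.length := by
  rw [norm_wordMul]
  induction l with
  | nil => simp
  | cons i l ih =>
    rw [List.map_cons, List.prod_cons, List.length_cons, pow_succ, mul_comm _ (2 * π * euclidNorm x)]
    refine mul_le_mul ?_ ih (List.prod_nonneg fun a ha => ?_)
      (mul_nonneg (by positivity) (euclidNorm_nonneg x))
    · exact mul_le_mul_of_nonneg_left (abs_apply_le_euclidNorm x i) (by positivity)
    · obtain ⟨j, -, rfl⟩ := List.mem_map.1 ha
      positivity

/-- For `F` supported in `S`, `F̂ = latticeFourier F` is the trigonometric polynomial with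
coefficients `F` (`Torus.trigPoly S F = Σ_{x ∈ S} e_x F(x)`). [folklore] -/
theorem latticeFourier_eq_trigPoly {S : Finset (Site d)} {F : Site d → ℝ}
    (hF : ∀ x ∉ S, F x = 0) : latticeFourier F = Torus.trigPoly S (fun x => (F x : ℂ)) := by
  funext t
  rw [Torus.trigPoly_apply]
  unfold latticeFourier
  rw [tsum_eq_sum (s := S) fun x hx => by rw [hF x hx]; simp]
  exact Finset.sum_congr rfl fun x _ => by rw [smul_eq_mul, mul_comm]

/-- `|Σ e_x c_x| ≤ Σ |c_x|`. [folklore] -/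
theorem norm_trigPoly_le (S : Finset (Site d)) (c : Site d → ℂ) (t : UnitAddTorus (Fin d)) :
    ‖Torus.trigPoly S c t‖ ≤ ∑ x ∈ S, ‖c x‖ := by
  rw [Torus.trigPoly_apply]
  refine (norm_sum_le _ _).trans (Finset.sum_le_sum fun x _ => ?_)
  rw [norm_smul, norm_mFourier_apply, one_mul]

/-- **`∂^l Σ e_x c_x = Σ e_x (2πi x)^l c_x`** for every word `l` (derivatives in reading order,
`iterL`; the tree's `Torus.partialDeriv_trigPoly'` iterated). [cite: LiuSlade2024, Appendix A, Lemma A.4 ("multiplication by a power corresponds to differentiation of the Fourier transform")] -/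
theorem iterL_trigPoly (S : Finset (Site d)) (c : Site d → ℂ) :
    ∀ l : List (Fin d), iterL l (Torus.trigPoly S c) = Torus.trigPoly S (fun x => wordMul l x * c x) := by
  intro l
  induction l using List.reverseRecOn with
  | nil =>
    funext t
    simp only [iterL_nil, wordMul_nil, one_mul]
  | append_singleton l j ih =>
    rw [iterL_concat, ih, Torus.partialDeriv_trigPoly']
    congr 1
    funext x
    rw [wordMul_append, smul_eq_mul]
    simp only [wordMul, List.map_cons, List.map_nil, List.prod_cons, List.prod_nil]
    ring

/-- Iterated derivatives of trigonometric polynomials are smooth. [folklore] -/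
theorem isSmooth_iterL_trigPoly (S : Finset (Site d)) (c : Site d → ℂ) (l : List (Fin d)) :
    IsSmooth (iterL l (Torus.trigPoly S c)) :=
  isSmooth_iterL (Torus.isSmooth_trigPoly S c) l

end TrigPoly

/-! ## Weak Lebesgue classes on the torus (Hölder bookkeeping)

The torus-side, complex-valued analogue of the cube-side classes `LS24.IsWL` of
`LaceExpansionGaussianDeconvolutionWL.lean` (same API, same proofs, for the Haar probability
measure of `𝕋^d`): a family `Φ = (Φ_i)` of functions `𝕋^d → ℂ` is of class `t` if
`sup_i ‖Φ_i‖_{L^p(𝕋^d)} < ∞` for every real `p ≥ 1` with `t/d < 1/p`. -/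

section WL

variable {ι : Type*}

/-- **The weak Lebesgue classes on `𝕋^d`.** `IsWLT d t Φ`: each `Φ_i : 𝕋^d → ℂ` is a.e. strongly
measurable and for every real `p ≥ 1` with `t/d < 1/p` the norms `‖Φ_i‖_{L^p(𝕋^d)}` are bounded
uniformly in `i` (the source's "`F̂_γ/F̂ ∈ L^q (q⁻¹ > |γ|/d)`", "`Ê_γ/(ÂF̂) ∈ L^q
(q⁻¹ > (2 - σ + |γ|)/d)`" of Lemma 2.5 are the classes `t = |γ|`, `t = 2 - σ + |γ|`, the index `i`
running over the admissible data so that constants are uniform). [cite: LiuSlade2024, Lemma 2.5 with (2.12)] -/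
structure IsWLT (d : ℕ) (t : ℝ) (Φ : ι → UnitAddTorus (Fin d) → ℂ) : Prop where
  aestronglyMeasurable : ∀ i, AEStronglyMeasurable (Φ i) volume
  bound : ∀ p : ℝ, 1 ≤ p → t / d < 1 / p →
    ∃ C : ℝ≥0, ∀ i, eLpNorm (Φ i) (ENNReal.ofReal p) volume ≤ C

/-- The zero family is of every class. [folklore] -/
theorem isWLT_zero (d : ℕ) (t : ℝ) : IsWLT d t (fun (_ : ι) (_ : UnitAddTorus (Fin d)) => (0 : ℂ)) :=
  ⟨fun _ => aestronglyMeasurable_const, fun _ _ _ => ⟨0, fun _ => by simp⟩⟩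

namespace IsWLT

variable {t t₁ t₂ : ℝ} {Φ Ψ : ι → UnitAddTorus (Fin d) → ℂ}

/-- Monotonicity in the class parameter. [folklore] -/
theorem mono (h : IsWLT d t₁ Φ) (ht : t₁ ≤ t₂) : IsWLT d t₂ Φ := by
  refine ⟨h.aestronglyMeasurable, fun p hp htp => h.bound p hp (lt_of_le_of_lt ?_ htp)⟩
  exact div_le_div_of_nonneg_right ht (Nat.cast_nonneg d)

/-- Pointwise domination `‖Ψ_i‖ ≤ c ‖Φ_i‖` (uniform `c`) transports the class. [folklore] -/
theorem of_le (h : IsWLT d t Φ) (hΨ : ∀ i, AEStronglyMeasurable (Ψ i) volume) {c : ℝ}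
    (hle : ∀ i t, ‖Ψ i t‖ ≤ c * ‖Φ i t‖) : IsWLT d t Ψ := by
  refine ⟨hΨ, fun p hp htp => ?_⟩
  obtain ⟨C, hC⟩ := h.bound p hp htp
  refine ⟨Real.toNNReal |c| * C, fun i => ?_⟩
  have hae : ∀ᵐ s ∂(volume : Measure (UnitAddTorus (Fin d))), ‖Ψ i s‖ ≤ |c| * ‖Φ i s‖ :=
    ae_of_all _ fun s =>
      (hle i s).trans (mul_le_mul_of_nonneg_right (le_abs_self c) (norm_nonneg _))
  calc eLpNorm (Ψ i) (ENNReal.ofReal p) volume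
      ≤ ENNReal.ofReal |c| * eLpNorm (Φ i) (ENNReal.ofReal p) volume :=
        eLpNorm_le_mul_eLpNorm_of_ae_le_mul hae (ENNReal.ofReal p)
    _ ≤ ENNReal.ofReal |c| * C := by gcongr; exact hC i
    _ = ((Real.toNNReal |c| * C : ℝ≥0) : ℝ≥0∞) := by
        rw [ENNReal.coe_mul, ENNReal.ofReal]

/-- Negation. [folklore] -/
theorem neg (h : IsWLT d t Φ) : IsWLT d t (fun i s => -Φ i s) := by
  refine ⟨fun i => (h.aestronglyMeasurable i).neg, fun p hp htp => ?_⟩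
  obtain ⟨C, hC⟩ := h.bound p hp htp
  exact ⟨C, fun i => by rw [show (fun s => -Φ i s) = -Φ i from rfl, eLpNorm_neg]; exact hC i⟩

/-- Sums. [folklore] -/
theorem add (h₁ : IsWLT d t Φ) (h₂ : IsWLT d t Ψ) : IsWLT d t (fun i s => Φ i s + Ψ i s) := by
  refine ⟨fun i => (h₁.aestronglyMeasurable i).add (h₂.aestronglyMeasurable i), fun p hp htp => ?_⟩
  obtain ⟨C₁, hC₁⟩ := h₁.bound p hp htp
  obtain ⟨C₂, hC₂⟩ := h₂.bound p hp htp
  refine ⟨C₁ + C₂, fun i => ?_⟩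
  have hp1 : (1 : ℝ≥0∞) ≤ ENNReal.ofReal p := by
    rw [← ENNReal.ofReal_one]; exact ENNReal.ofReal_le_ofReal hp
  calc eLpNorm (fun s => Φ i s + Ψ i s) (ENNReal.ofReal p) volume
      = eLpNorm (Φ i + Ψ i) (ENNReal.ofReal p) volume := rfl
    _ ≤ eLpNorm (Φ i) (ENNReal.ofReal p) volume + eLpNorm (Ψ i) (ENNReal.ofReal p) volume :=
        eLpNorm_add_le (h₁.aestronglyMeasurable i) (h₂.aestronglyMeasurable i) hp1
    _ ≤ C₁ + C₂ := add_le_add (hC₁ i) (hC₂ i)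
    _ = ((C₁ + C₂ : ℝ≥0) : ℝ≥0∞) := (ENNReal.coe_add _ _).symm

/-- Differences. [folklore] -/
theorem sub (h₁ : IsWLT d t Φ) (h₂ : IsWLT d t Ψ) : IsWLT d t (fun i s => Φ i s - Ψ i s) := by
  have := h₁.add h₂.neg
  simpa [sub_eq_add_neg] using this

/-- Scalar multiples with coefficients bounded uniformly in the index. [folklore] -/
theorem const_mul (h : IsWLT d t Φ) {c : ι → ℂ} {M : ℝ} (hc : ∀ i, ‖c i‖ ≤ M) :
    IsWLT d t (fun i s => c i * Φ i s) := by
  refine h.of_le (fun i => (h.aestronglyMeasurable i).const_mul (c i)) (c := M) fun i s => ?_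
  rw [norm_mul]
  exact mul_le_mul_of_nonneg_right (hc i) (norm_nonneg _)

/-- Finite sums of families of the same class. [folklore] -/
theorem finset_sum {κ : Type*} (s : Finset κ) {Φ : κ → ι → UnitAddTorus (Fin d) → ℂ}
    (h : ∀ j ∈ s, IsWLT d t (Φ j)) : IsWLT d t (fun i u => ∑ j ∈ s, Φ j i u) := by
  classical
  induction s using Finset.induction_on with
  | empty => simpa using isWLT_zero (ι := ι) d t
  | insert a s ha ih =>
    have h1 : IsWLT d t (Φ a) := h a (Finset.mem_insert_self a s)
    have h2 := ih fun j hj => h j (Finset.mem_insert_of_mem hj)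
    have := h1.add h2
    simpa [Finset.sum_insert ha] using this

/-- Re-indexing along a map of index sets. [folklore] -/
theorem comp {ι' : Type*} (h : IsWLT d t Φ) (f : ι' → ι) : IsWLT d t (fun i => Φ (f i)) :=
  ⟨fun i => h.aestronglyMeasurable (f i), fun p hp htp => by
    obtain ⟨C, hC⟩ := h.bound p hp htp
    exact ⟨C, fun i => hC (f i)⟩⟩

end IsWLT

/-- **Bounded families are of class `0`** (hence of every class `t ≥ 0`): `‖Φ_i‖_p ≤ M` on the
probability space `𝕋^d`. [folklore] -/
theorem isWLT_of_bounded {Φ : ι → UnitAddTorus (Fin d) → ℂ}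
    (hΦ : ∀ i, AEStronglyMeasurable (Φ i) volume) {M : ℝ}
    (hle : ∀ i s, ‖Φ i s‖ ≤ M) {t : ℝ} (ht : 0 ≤ t) : IsWLT d t Φ := by
  refine IsWLT.mono ?_ ht
  refine ⟨hΦ, fun p hp _ => ⟨(ENNReal.ofReal M).toNNReal, fun i => ?_⟩⟩
  have hae : ∀ᵐ s ∂(volume : Measure (UnitAddTorus (Fin d))), ‖Φ i s‖ ≤ M :=
    ae_of_all _ fun s => hle i s
  have h := eLpNorm_le_of_ae_bound (p := ENNReal.ofReal p) hae
  rw [measure_univ, ENNReal.one_rpow, one_mul] at h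
  rwa [ENNReal.coe_toNNReal ENNReal.ofReal_ne_top]

/-- **The product rule (Hölder's inequality)**: `IsWLT t₁ Φ → IsWLT t₂ Ψ → IsWLT (t₁ + t₂) (Φ Ψ)`
for `t₁, t₂ ≥ 0`. [cite: LiuSlade2024, proof of Proposition 2.4 (§2.2.1: "By Lemma 2.5 and Hölder's inequality")] -/
theorem IsWLT.mul {t₁ t₂ : ℝ} {Φ Ψ : ι → UnitAddTorus (Fin d) → ℂ} (hd : 0 < d) (ht₁ : 0 ≤ t₁)
    (ht₂ : 0 ≤ t₂) (h₁ : IsWLT d t₁ Φ) (h₂ : IsWLT d t₂ Ψ) :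
    IsWLT d (t₁ + t₂) (fun i s => Φ i s * Ψ i s) := by
  have hdR : 0 < (d : ℝ) := by exact_mod_cast hd
  refine ⟨fun i => (h₁.aestronglyMeasurable i).mul (h₂.aestronglyMeasurable i), fun p hp htp => ?_⟩
  obtain ⟨p₁, p₂, hp₁, hp₂, hsum, hlt₁, hlt₂⟩ := LS24.exists_exponent_split hdR ht₁ ht₂ hp htp
  obtain ⟨C₁, hC₁⟩ := h₁.bound p₁ hp₁ hlt₁
  obtain ⟨C₂, hC₂⟩ := h₂.bound p₂ hp₂ hlt₂
  haveI := LS24.holderTriple_ofReal (by linarith) (by linarith) (by linarith) hsum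
  refine ⟨C₁ * C₂, fun i => ?_⟩
  have h := eLpNorm_le_eLpNorm_mul_eLpNorm_of_nnnorm (μ := (volume : Measure (UnitAddTorus (Fin d))))
    (p := ENNReal.ofReal p₁) (q := ENNReal.ofReal p₂) (r := ENNReal.ofReal p)
    (h₁.aestronglyMeasurable i) (h₂.aestronglyMeasurable i) (fun a b : ℂ => a * b) 1
    (ae_of_all _ fun k => by simp)
  calc eLpNorm (fun s => Φ i s * Ψ i s) (ENNReal.ofReal p) volume
      ≤ (1 : ℝ≥0) * eLpNorm (Φ i) (ENNReal.ofReal p₁) volume * eLpNorm (Ψ i) (ENNReal.ofReal p₂) volume := h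
    _ ≤ (1 : ℝ≥0) * C₁ * C₂ := by gcongr <;> first | exact hC₁ i | exact hC₂ i
    _ = ((C₁ * C₂ : ℝ≥0) : ℝ≥0∞) := by push_cast; ring

/-- Finite products `Π_{j ∈ s} Φ^{(j)}` with `IsWLT (t j) Φ^{(j)}`, `t j ≥ 0`, are of class
`Σ_{j ∈ s} t j`. [cite: LiuSlade2024, proof of Proposition 2.4 (§2.2.1)] -/
theorem IsWLT.finset_prod {κ : Type*} (hd : 0 < d) (s : Finset κ)
    {Φ : κ → ι → UnitAddTorus (Fin d) → ℂ} {t : κ → ℝ} (ht : ∀ j ∈ s, 0 ≤ t j)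
    (h : ∀ j ∈ s, IsWLT d (t j) (Φ j)) :
    IsWLT d (∑ j ∈ s, t j) (fun i u => ∏ j ∈ s, Φ j i u) := by
  classical
  induction s using Finset.induction_on with
  | empty =>
    simp only [Finset.sum_empty, Finset.prod_empty]
    exact isWLT_of_bounded (fun _ => aestronglyMeasurable_const) (M := 1) (fun _ _ => by simp) le_rfl
  | insert a s ha ih =>
    have h1 : IsWLT d (t a) (Φ a) := h a (Finset.mem_insert_self a s)
    have h2 := ih (fun j hj => ht j (Finset.mem_insert_of_mem hj))
      (fun j hj => h j (Finset.mem_insert_of_mem hj))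
    have hs : 0 ≤ ∑ j ∈ s, t j := Finset.sum_nonneg fun j hj => ht j (Finset.mem_insert_of_mem hj)
    have := h1.mul hd (ht a (Finset.mem_insert_self a s)) hs h2
    simpa [Finset.sum_insert ha, Finset.prod_insert ha] using this

/-- List products `Π_{w ∈ l} Φ^{(w)}` (with repetitions) with `IsWLT (t w) Φ^{(w)}`, `t w ≥ 0`, are
of class `Σ_{w ∈ l} t w`. [cite: LiuSlade2024, proof of Proposition 2.4 (§2.2.1)] -/
theorem IsWLT.list_prod {κ : Type*} (hd : 0 < d) {Φ : κ → ι → UnitAddTorus (Fin d) → ℂ}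
    {t : κ → ℝ} : ∀ l : List κ, (∀ w ∈ l, 0 ≤ t w) → (∀ w ∈ l, IsWLT d (t w) (Φ w)) →
      IsWLT d (l.map t).sum (fun i u => (l.map fun w => Φ w i u).prod)
  | [], _, _ => by
    simp only [List.map_nil, List.sum_nil, List.prod_nil]
    exact isWLT_of_bounded (fun _ => aestronglyMeasurable_const) (M := 1) (fun _ _ => by simp) le_rfl
  | w :: l, ht, h => by
    have h1 : IsWLT d (t w) (Φ w) := h w List.mem_cons_self
    have h2 := IsWLT.list_prod hd l (fun v hv => ht v (List.mem_cons_of_mem w hv))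
      (fun v hv => h v (List.mem_cons_of_mem w hv))
    have hs : 0 ≤ (l.map t).sum :=
      List.sum_nonneg fun x hx => by
        obtain ⟨v, hv, rfl⟩ := List.mem_map.1 hx
        exact ht v (List.mem_cons_of_mem w hv)
    have := h1.mul hd (ht w List.mem_cons_self) hs h2
    simpa [List.map_cons, List.sum_cons, List.prod_cons] using this

/-- **`L¹` bounds from the class**: if `IsWLT t Φ` with `t < d` then the `Φ_i` are integrable with
`∫_{𝕋^d} ‖Φ_i‖ ≤ C` uniformly in `i`. [cite: LiuSlade2024, proof of Proposition 2.4 (§2.2.1: "We can take r = 1")] -/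
theorem IsWLT.exists_integral_le {t : ℝ} {Φ : ι → UnitAddTorus (Fin d) → ℂ} (h : IsWLT d t Φ)
    (hd : 0 < d) (ht : t < d) :
    ∃ C : ℝ, ∀ i, Integrable (Φ i) ∧ ∫ s, ‖Φ i s‖ ≤ C := by
  have hdR : 0 < (d : ℝ) := by exact_mod_cast hd
  obtain ⟨C, hC⟩ := h.bound 1 le_rfl (by rw [div_lt_iff₀ hdR]; linarith)
  refine ⟨C, fun i => ?_⟩
  have h1 : eLpNorm (Φ i) 1 volume ≤ C := by simpa using hC i
  rw [eLpNorm_one_eq_lintegral_enorm] at h1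
  have hint : Integrable (Φ i) :=
    ⟨h.aestronglyMeasurable i, (hasFiniteIntegral_iff_enorm).2 (h1.trans_lt ENNReal.coe_lt_top)⟩
  refine ⟨hint, ?_⟩
  rw [integral_norm_eq_lintegral_enorm (h.aestronglyMeasurable i)]
  exact ENNReal.toReal_le_coe_of_le_coe h1

/-- **`L^{p}` bounds from the class at one admissible exponent**, real form: if `IsWLT t Φ` and
`p ≥ 1` with `t/d < 1/p`, then `∫ ‖Φ_i‖^p ≤ C` uniformly in `i`. [folklore] -/
theorem IsWLT.exists_integral_rpow_le {t : ℝ} {Φ : ι → UnitAddTorus (Fin d) → ℂ} (h : IsWLT d t Φ)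
    {p : ℝ} (hp : 1 ≤ p) (htp : t / d < 1 / p) :
    ∃ C : ℝ, ∀ i, MemLp (Φ i) (ENNReal.ofReal p) ∧ ∫ s, ‖Φ i s‖ ^ p ≤ C := by
  obtain ⟨C, hC⟩ := h.bound p hp htp
  have hp0 : 0 < p := by linarith
  refine ⟨(C : ℝ) ^ p, fun i => ?_⟩
  have hmem : MemLp (Φ i) (ENNReal.ofReal p) := ⟨h.aestronglyMeasurable i, (hC i).trans_lt ENNReal.coe_lt_top⟩
  refine ⟨hmem, ?_⟩
  have hne0 : ENNReal.ofReal p ≠ 0 := by simpa using hp0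
  have h1 := hmem.eLpNorm_eq_integral_rpow_norm hne0 ENNReal.ofReal_ne_top
  rw [ENNReal.toReal_ofReal hp0.le] at h1
  have h2 : ENNReal.ofReal ((∫ s, ‖Φ i s‖ ^ p) ^ p⁻¹) ≤ C := h1 ▸ hC i
  have h3 : (∫ s, ‖Φ i s‖ ^ p) ^ p⁻¹ ≤ C := by
    have := ENNReal.toReal_mono ENNReal.coe_ne_top h2
    rwa [ENNReal.toReal_ofReal (Real.rpow_nonneg (integral_nonneg fun _ => by positivity) _),
      ENNReal.coe_toReal] at this
  have hI : 0 ≤ ∫ s, ‖Φ i s‖ ^ p := integral_nonneg fun _ => by positivity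
  calc ∫ s, ‖Φ i s‖ ^ p = ((∫ s, ‖Φ i s‖ ^ p) ^ p⁻¹) ^ p := by
        rw [← Real.rpow_mul hI, inv_mul_cancel₀ hp0.ne', Real.rpow_one]
    _ ≤ (C : ℝ) ^ p := Real.rpow_le_rpow (Real.rpow_nonneg hI _) h3 hp0.le

/-- **Power weights**: for `s ≥ 0` the (constant) family `t ↦ ‖t‖^{-s}` is of class `s`
(`∫_{𝕋^d} ‖t‖^{-sp} dt < ∞` for `sp < d`). Through the infrared bounds these dominate `1/F̂`,
`1/Â`. [cite: LiuSlade2024, proof of Lemma 2.5 (§2.2.2: "∈ L^q (q⁻¹ > (|γ|∧2)/d)")] -/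
theorem isWLT_tnorm_rpow_neg (hd : 1 ≤ d) {s : ℝ} (hs : 0 ≤ s) :
    IsWLT d s (fun (_ : ι) (u : UnitAddTorus (Fin d)) => ((tnorm u ^ (-s) : ℝ) : ℂ)) := by
  have hdR : 0 < (d : ℝ) := by exact_mod_cast (show 0 < d by omega)
  have hmeas : AEStronglyMeasurable (fun u : UnitAddTorus (Fin d) => ((tnorm u ^ (-s) : ℝ) : ℂ)) volume :=
    (Complex.continuous_ofReal.measurable.comp (continuous_tnorm.measurable.pow_const _)).aestronglyMeasurable
  refine ⟨fun _ => hmeas, fun p hp hsp => ?_⟩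
  have hp0 : 0 < p := by linarith
  have hspd : s * p < d := by
    rw [div_lt_div_iff₀ hdR hp0, one_mul] at hsp
    linarith
  have hmem := memLp_tnorm_rpow_neg hd hs hp0 hspd
  have hmemC : MemLp (fun u : UnitAddTorus (Fin d) => ((tnorm u ^ (-s) : ℝ) : ℂ)) (ENNReal.ofReal p) :=
    hmem.ofReal
  refine ⟨(eLpNorm (fun u : UnitAddTorus (Fin d) => ((tnorm u ^ (-s) : ℝ) : ℂ)) (ENNReal.ofReal p)
    volume).toNNReal, fun _ => ?_⟩
  rw [ENNReal.coe_toNNReal hmemC.eLpNorm_ne_top]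

/-- A family dominated by a power weight, `‖Φ_i(u)‖ ≤ c ‖u‖^{-s}` with `s ≥ 0`, is of class `s`.
[cite: LiuSlade2024, proof of Lemma 2.5 (§2.2.2)] -/
theorem isWLT_of_le_tnorm_rpow_neg (hd : 1 ≤ d) {s : ℝ} (hs : 0 ≤ s)
    {Φ : ι → UnitAddTorus (Fin d) → ℂ} (hΦ : ∀ i, AEStronglyMeasurable (Φ i) volume) {c : ℝ}
    (hle : ∀ i u, ‖Φ i u‖ ≤ c * tnorm u ^ (-s)) : IsWLT d s Φ := by
  refine (isWLT_tnorm_rpow_neg (ι := ι) hd hs).of_le hΦ (c := c) fun i u => ?_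
  rw [Complex.norm_real, Real.norm_eq_abs, abs_of_nonneg (Real.rpow_nonneg (tnorm_nonneg u) _)]
  exact hle i u

/-- **Classes from `L^q` bounds at large exponents** (the form in which the Hausdorff–Young-type
bounds enter): if for every real `q ≥ 2` with `t/d < 1/q` the norms `‖Φ_i‖_q` are uniformly
bounded, and also `‖Φ_i‖₂` is uniformly bounded, then `Φ` is of class `t` (for `p < 2` use
`‖·‖_p ≤ ‖·‖₂` on the probability space `𝕋^d`). [cite: LiuSlade2024, Lemma 2.6 (ii) ("The extension to 1 ≤ q follows from monotonicity of the L^q norm in q")] -/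
theorem isWLT_of_bound_two_le {t : ℝ} {Φ : ι → UnitAddTorus (Fin d) → ℂ}
    (hΦ : ∀ i, AEStronglyMeasurable (Φ i) volume)
    (h2 : ∃ C : ℝ≥0, ∀ i, eLpNorm (Φ i) 2 volume ≤ C)
    (hq : ∀ q : ℝ, 2 ≤ q → t / d < 1 / q → ∃ C : ℝ≥0, ∀ i, eLpNorm (Φ i) (ENNReal.ofReal q) volume ≤ C) :
    IsWLT d t Φ := by
  refine ⟨hΦ, fun p hp htp => ?_⟩
  rcases le_or_gt 2 p with h | h
  · exact hq p h htp
  · obtain ⟨C, hC⟩ := h2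
    refine ⟨C, fun i => le_trans ?_ (hC i)⟩
    have hle : ENNReal.ofReal p ≤ 2 := by
      rw [← ENNReal.ofReal_ofNat]; exact ENNReal.ofReal_le_ofReal h.le
    have := eLpNorm_le_eLpNorm_mul_rpow_measure_univ hle (hΦ i) (μ := volume)
    rwa [measure_univ, ENNReal.one_rpow, mul_one] at this

end WL

end Literature.Barriers.CriticalPhenomena.SpreadOutIsing

end
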